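import Summits.CriticalPhenomena.PercolationContinuityZ3.Theorems.PercNearOneGluingNoHeavyLowerTailSahiE3PatternReduction
import Mathlib.Data.Fintype.Pi
import Mathlib.Data.Fin.VecNotation
import Mathlib.Tactic.Linarith
import Mathlib.Tactic.FinCases
import HarnessLib
import HarnessLib.Audit

/-!
# `NoHeavyLowerTail` (crux stmt-CriticalPhenomena-4575), Sahi programme P4 (Holley / monotone coupling):
# the maj-slot certificate on the pattern `2³` — combinatorial interface 1/4: saturated up-sets; pair condition rows
      `∅, ⊤, ↑(xy)`

Support file (cell `prim-l12`, seat P4, generation 9; `--supports stmt-CriticalPhenomena-4575`).  No named facts,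
      no sorries; standard
axioms; def-free; no notation (the slot set is passed as `(M, hM : M = {110, 101, 011, 111})`).

The pattern is `P = Fin 3 → Bool` (patterns of three join-primes `j₀, j₁, j₂`: coordinate `i` records `jᵢ ≤ x`),
      the slot set is the
majority pattern `MAJ = {110, 101, 011, 111}` (preimage: `↑(j₀⊔j₁) ∪ ↑(j₀⊔j₂) ∪ ↑(j₁⊔j₂)`),
      `ν` a weight on `P` with point masses
`nE` (bottom), `n0, n1, n2` (atoms), `n01, n02, n12` (rank two), `nT` (top) and total mass `Z`,
      and `R` retained masses with values
`r01, r02, r12, rT` on `MAJ`.  All inequality texts are generated from ONE specification (HOME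
      prim-l12-p4/code/gen9/spec.py) and are
consumed verbatim across the files `…SahiE3MajPattern*`, `…SahiE3MajCert*`, `…SahiE3MajCore`, `…SahiE3MajSlot`.
* `sat_cases`: a `MAJ`-saturated up-set of `2³` (an up-set containing every point outside `MAJ` all of whose
      `MAJ`-successors it
  contains — the only up-sets the trace reduction `…SahiE3PatternReduction.pair_of_saturated` needs) is one of nine
        explicit sets:
  `∅, {⊤}, ↑(xy) (3), ↑x (3), P`.
* `pair_row_*`: for each of them as first argument,
      the pair inequality of `…SahiE3PatternCertificate.phi_nonneg_of_patternCertificate`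
  against all nine second arguments, from the matching items of the canonical list (up-transport `ut_*`, `total`,
        `pair_*`).
  This file: rows `∅, {⊤}, ↑(01), ↑(02), ↑(12)`; rows `↑0, ↑1, ↑2, P` are in `…SahiE3MajPatternRows2`.
-/

namespace Summit.CriticalPhenomena.PercolationContinuityZ3.Theorems.SahiE3MajPattern

open Finset
open scoped BigOperators


/-- The eight points of the pattern `2³`. [folklore] -/
theorem pts (x : Fin 3 → Bool) :
    x = ![false, false, false] ∨ x = ![true, false, false] ∨ x = ![false, true, false] ∨ x = ![false, false,
          true] ∨ x = ![true, true, false] ∨ x = ![true, false, true] ∨ x = ![false, true, true] ∨ x = ![true, true,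
          true] := by
  revert x; decide

/-- Order facts of the pattern `2³` used below (bottom, top, atoms below their two rank-2 elements, and the three
non-comparabilities atom / opposite rank-2 element). [folklore] -/
theorem ord :
    (∀ x : Fin 3 → Bool, ![false, false, false] ≤ x) ∧ (∀ x : Fin 3 → Bool, x ≤ ![true, true, true]) ∧
    ![true, false, false] ≤ ![true, true, false] ∧ ![true, false, false] ≤ ![true, false, true] ∧ ![false, true,
          false] ≤ ![true, true, false] ∧ ![false, true, false] ≤ ![false, true, true] ∧ ![false, false,
          true] ≤ ![true, false, true] ∧ ![false, false, true] ≤ ![false, true, true] ∧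
    ¬ ![true, false, false] ≤ ![false, true, true] ∧ ¬ ![false, true, false] ≤ ![true, false, true] ∧ ¬ ![false,
          false, true] ≤ ![true, true, false] := by
  letI : DecidableLE (Fin 3 → Bool) := fun a b => inferInstanceAs (Decidable (∀ i, a i ≤ b i))
  decide

/-- The `({![true, true, false], ![true, false, true], ![false, true, true], ![true, true,
      true]} : Finset (Fin 3 → Bool))`-saturated up-sets of `2³` (an up-set `S` such that an element outside
      `({![true, true, false], ![true, false, true], ![false, true, true], ![true, true,
      true]} : Finset (Fin 3 → Bool))` all of whose `({![true, true, false], ![true, false, true], ![false, true,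
      true], ![true, true, true]} : Finset (Fin 3 → Bool))`-successors lie in
`S` lies in `S`) are exactly: `∅`, `{⊤}`, the three `↑(ij)`, the three `↑i`, and everything. [this work] -/
theorem sat_cases (M : Finset (Fin 3 → Bool))
    (hM : M = {![true, true, false], ![true, false, true], ![false, true, true], ![true, true,
          true]}) (S : Finset (Fin 3 → Bool)) (hS : IsUpperSet (S : Set (Fin 3 → Bool)))
    (hsat : ∀ s ∈ Mᶜ, (∀ t ∈ M, s ≤ t → t ∈ S) → s ∈ S) :
    S = ∅ ∨ S = {![true, true, true]} ∨ S = {![true, true, false], ![true, true, true]} ∨ S = {![true, false, true],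
          ![true, true, true]} ∨ S = {![false, true, true], ![true, true, true]} ∨
      S = {![true, false, false], ![true, true, false], ![true, false, true], ![true, true, true]} ∨ S = {![false,
            true, false], ![true, true, false], ![false, true, true], ![true, true, true]} ∨ S = {![false, false,
            true], ![true, false, true], ![false, true, true], ![true, true, true]} ∨ S = univ := by
  subst hM
  obtain ⟨hbot, htop, l001, l002, l101, l112, l202, l212, n0, n1, n2⟩ := ord
  have up : ∀ {x y : Fin 3 → Bool}, x ≤ y → x ∈ S → y ∈ S := fun hxy hx => hS hxy hx
  by_cases hb : ![false, false, false] ∈ S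
  · refine Or.inr (Or.inr (Or.inr (Or.inr (Or.inr (Or.inr (Or.inr (Or.inr ?_)))))))
    ext x
    simp only [Finset.mem_univ, iff_true]
    exact up (hbot x) hb
  by_cases ht : ![true, true, true] ∈ S
  swap
  · refine Or.inl ?_
    ext x
    simp only [Finset.notMem_empty, iff_false]
    exact fun hx => ht (up (htop x) hx)
  -- atoms are in `S` iff both rank-2 elements above them are
  have mem4 : ∀ {t : Fin 3 → Bool}, t ∈ ({![true, true, false], ![true, false, true], ![false, true, true], ![true,
        true, true]} : Finset (Fin 3 → Bool)) → t = ![true, true, false] ∨ t = ![true, false, true] ∨ t = ![false,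
        true, true] ∨ t = ![true, true, true] := by
    intro t h
    simpa only [Finset.mem_insert, Finset.mem_singleton] using h
  have h0 : ![true, false, false] ∈ S ↔ ![true, true, false] ∈ S ∧ ![true, false, true] ∈ S := by
    refine ⟨fun h => ⟨up l001 h, up l002 h⟩, fun h => hsat _ (by decide) fun t htM hle => ?_⟩
    rcases mem4 htM with rfl | rfl | rfl | rfl
    exacts [h.1, h.2, absurd hle n0, ht]
  have h1 : ![false, true, false] ∈ S ↔ ![true, true, false] ∈ S ∧ ![false, true, true] ∈ S := by
    refine ⟨fun h => ⟨up l101 h, up l112 h⟩, fun h => hsat _ (by decide) fun t htM hle => ?_⟩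
    rcases mem4 htM with rfl | rfl | rfl | rfl
    exacts [h.1, absurd hle n1, h.2, ht]
  have h2 : ![false, false, true] ∈ S ↔ ![true, false, true] ∈ S ∧ ![false, true, true] ∈ S := by
    refine ⟨fun h => ⟨up l202 h, up l212 h⟩, fun h => hsat _ (by decide) fun t htM hle => ?_⟩
    rcases mem4 htM with rfl | rfl | rfl | rfl
    exacts [absurd hle n2, h.1, h.2, ht]
  have hnot : ¬ (![true, true, false] ∈ S ∧ ![true, false, true] ∈ S ∧ ![false, true, true] ∈ S) := fun h =>
    hb (hsat _ (by decide) fun t htM _ => by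
      rcases mem4 htM with rfl | rfl | rfl | rfl
      exacts [h.1, h.2.1, h.2.2, ht])
  by_cases c01 : ![true, true, false] ∈ S <;> by_cases c02 : ![true, false, true] ∈ S <;> by_cases c12 : ![false,
        true, true] ∈ S
  · exact absurd ⟨c01, c02, c12⟩ hnot
  all_goals
    have a0 := h0; have a1 := h1; have a2 := h2
    simp only [c01, c02, c12, and_true, and_false, iff_true, iff_false] at a0 a1 a2
  · -- 01, 02 : R0
    refine Or.inr (Or.inr (Or.inr (Or.inr (Or.inr (Or.inl ?_)))))
    ext x; rcases pts x with rfl | rfl | rfl | rfl | rfl | rfl | rfl | rfl <;> simp [hb, ht, c01, c02, c12, a0, a1,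
          a2]
  · -- 01, 12 : R1
    refine Or.inr (Or.inr (Or.inr (Or.inr (Or.inr (Or.inr (Or.inl ?_))))))
    ext x; rcases pts x with rfl | rfl | rfl | rfl | rfl | rfl | rfl | rfl <;> simp [hb, ht, c01, c02, c12, a0, a1,
          a2]
  · -- 01 : P01
    refine Or.inr (Or.inr (Or.inl ?_))
    ext x; rcases pts x with rfl | rfl | rfl | rfl | rfl | rfl | rfl | rfl <;> simp [hb, ht, c01, c02, c12, a0, a1,
          a2]
  · -- 02, 12 : R2
    refine Or.inr (Or.inr (Or.inr (Or.inr (Or.inr (Or.inr (Or.inr (Or.inl ?_)))))))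
    ext x; rcases pts x with rfl | rfl | rfl | rfl | rfl | rfl | rfl | rfl <;> simp [hb, ht, c01, c02, c12, a0, a1,
          a2]
  · -- 02 : P02
    refine Or.inr (Or.inr (Or.inr (Or.inl ?_)))
    ext x; rcases pts x with rfl | rfl | rfl | rfl | rfl | rfl | rfl | rfl <;> simp [hb, ht, c01, c02, c12, a0, a1,
          a2]
  · -- 12 : P12
    refine Or.inr (Or.inr (Or.inr (Or.inr (Or.inl ?_))))
    ext x; rcases pts x with rfl | rfl | rfl | rfl | rfl | rfl | rfl | rfl <;> simp [hb, ht, c01, c02, c12, a0, a1,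
          a2]
  · -- none : {T}
    refine Or.inr (Or.inl ?_)
    ext x; rcases pts x with rfl | rfl | rfl | rfl | rfl | rfl | rfl | rfl <;> simp [hb, ht, c01, c02, c12, a0, a1,
          a2]

/-- Row `S = empty` of the pair condition: the nine saturated `S'` (see `pair_all`). [this work] -/
theorem pair_row_empty (M : Finset (Fin 3 → Bool))
    (hM : M = {![true, true, false], ![true, false, true], ![false, true, true], ![true, true,
          true]}) (ν : (Fin 3 → Bool) → ℝ) (n0 n1 n2 n01 n02 n12 nT Z : ℝ)
    (hZ : ∑ t, ν t = Z) (h0 : ν ![true, false, false] = n0) (h1 : ν ![false, true, false] = n1) (h2 : ν ![false,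
          false, true] = n2)
    (h01 : ν ![true, true, false] = n01) (h02 : ν ![true, false, true] = n02) (h12 : ν ![false, true,
          true] = n12) (hT : ν ![true, true, true] = nT)
    (R : (Fin 3 → Bool) → ℝ) 
    (S' : Finset (Fin 3 → Bool)) (hS' : IsUpperSet (S' : Set (Fin 3 → Bool)))
    (hsS' : ∀ s ∈ Mᶜ, (∀ t ∈ M, s ≤ t → t ∈ S') → s ∈ S') :
    Z * ((∑ t ∈ (∅ : Finset (Fin 3 → Bool)), ν t) * (∑ t ∈ S' ∩ M, ν t)
        + (∑ t ∈ S', ν t) * (∑ t ∈ (∅ : Finset (Fin 3 → Bool)) ∩ M, ν t))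
        - (n01 + n02 + n12 + nT) * (∑ t ∈ (∅ : Finset (Fin 3 → Bool)), ν t) * (∑ t ∈ S', ν t)
      ≤ ∑ t ∈ ((∅ : Finset (Fin 3 → Bool)) ∩ S') ∩ M, R t := by
  subst hM
  rcases sat_cases _ rfl S' hS' hsS' with rfl | rfl | rfl | rfl | rfl | rfl | rfl | rfl | rfl <;>
  · simp (disch := decide) only [Finset.empty_inter, Finset.inter_empty, Finset.univ_inter, Finset.inter_univ,
      Finset.insert_inter_of_mem, Finset.insert_inter_of_notMem, Finset.singleton_inter_of_mem,
      Finset.sum_empty, Finset.sum_singleton, Finset.sum_insert, hZ,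
      h0, h1, h2, h01, h02, h12, hT]
    linarith

/-- Row `S = T` of the pair condition: the nine saturated `S'` (see `pair_all`). [this work] -/
theorem pair_row_T (M : Finset (Fin 3 → Bool))
    (hM : M = {![true, true, false], ![true, false, true], ![false, true, true], ![true, true,
          true]}) (ν : (Fin 3 → Bool) → ℝ) (n0 n1 n2 n01 n02 n12 nT Z : ℝ)
    (hZ : ∑ t, ν t = Z) (h0 : ν ![true, false, false] = n0) (h1 : ν ![false, true, false] = n1) (h2 : ν ![false,
          false, true] = n2)
    (h01 : ν ![true, true, false] = n01) (h02 : ν ![true, false, true] = n02) (h12 : ν ![false, true,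
          true] = n12) (hT : ν ![true, true, true] = nT) (rT : ℝ)
    (R : (Fin 3 → Bool) → ℝ) (hRT : R ![true, true, true] = rT)
    (h_pair_T_T : Z * (nT * nT + nT * nT) - (n01 + n02 + n12 + nT) * nT * nT ≤ rT)
    (h_pair_T_P01 : Z * (nT * (n01 + nT) + (n01 + nT) * nT) - (n01 + n02 + n12 + nT) * nT * (n01 + nT) ≤ rT)
    (h_pair_T_P02 : Z * (nT * (n02 + nT) + (n02 + nT) * nT) - (n01 + n02 + n12 + nT) * nT * (n02 + nT) ≤ rT)
    (h_pair_T_P12 : Z * (nT * (n12 + nT) + (n12 + nT) * nT) - (n01 + n02 + n12 + nT) * nT * (n12 + nT) ≤ rT)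
    (h_pair_T_R0 : Z * (nT * (n01 + n02 + nT) + (n0 + n01 + n02 + nT) * nT) - (n01 + n02 + n12 + nT) * nT * (n0 +
          n01 + n02 + nT) ≤ rT)
    (h_pair_T_R1 : Z * (nT * (n01 + n12 + nT) + (n1 + n01 + n12 + nT) * nT) - (n01 + n02 + n12 + nT) * nT * (n1 +
          n01 + n12 + nT) ≤ rT)
    (h_pair_T_R2 : Z * (nT * (n02 + n12 + nT) + (n2 + n02 + n12 + nT) * nT) - (n01 + n02 + n12 + nT) * nT * (n2 +
          n02 + n12 + nT) ≤ rT)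
    (h_ut_T : Z * Z * nT ≤ rT)
    (S' : Finset (Fin 3 → Bool)) (hS' : IsUpperSet (S' : Set (Fin 3 → Bool)))
    (hsS' : ∀ s ∈ Mᶜ, (∀ t ∈ M, s ≤ t → t ∈ S') → s ∈ S') :
    Z * ((∑ t ∈ ({![true, true, true]} : Finset (Fin 3 → Bool)), ν t) * (∑ t ∈ S' ∩ M, ν t)
        + (∑ t ∈ S', ν t) * (∑ t ∈ ({![true, true, true]} : Finset (Fin 3 → Bool)) ∩ M, ν t))
        - (n01 + n02 + n12 + nT) * (∑ t ∈ ({![true, true, true]} : Finset (Fin 3 → Bool)), ν t) * (∑ t ∈ S', ν t)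
      ≤ ∑ t ∈ (({![true, true, true]} : Finset (Fin 3 → Bool)) ∩ S') ∩ M, R t := by
  subst hM
  rcases sat_cases _ rfl S' hS' hsS' with rfl | rfl | rfl | rfl | rfl | rfl | rfl | rfl | rfl <;>
  · simp (disch := decide) only [Finset.empty_inter, Finset.inter_empty, Finset.univ_inter, Finset.inter_univ,
      Finset.insert_inter_of_mem, Finset.insert_inter_of_notMem, Finset.singleton_inter_of_mem,
      Finset.sum_empty, Finset.sum_singleton, Finset.sum_insert, hZ,
      hRT, h0, h1, h2, h01, h02, h12, hT]
    linarith

/-- Row `S = P01` of the pair condition: the nine saturated `S'` (see `pair_all`). [this work] -/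
theorem pair_row_P01 (M : Finset (Fin 3 → Bool))
    (hM : M = {![true, true, false], ![true, false, true], ![false, true, true], ![true, true,
          true]}) (ν : (Fin 3 → Bool) → ℝ) (n0 n1 n2 n01 n02 n12 nT Z : ℝ)
    (hZ : ∑ t, ν t = Z) (h0 : ν ![true, false, false] = n0) (h1 : ν ![false, true, false] = n1) (h2 : ν ![false,
          false, true] = n2)
    (h01 : ν ![true, true, false] = n01) (h02 : ν ![true, false, true] = n02) (h12 : ν ![false, true,
          true] = n12) (hT : ν ![true, true, true] = nT) (r01 rT : ℝ)
    (R : (Fin 3 → Bool) → ℝ) (hR01 : R ![true, true, false] = r01) (hRT : R ![true, true, true] = rT)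
    (h_pair_T_P01 : Z * (nT * (n01 + nT) + (n01 + nT) * nT) - (n01 + n02 + n12 + nT) * nT * (n01 + nT) ≤ rT)
    (h_pair_P01_P01 : Z * ((n01 + nT) * (n01 + nT) + (n01 + nT) * (n01 + nT)) - (n01 + n02 + n12 + nT) * (n01 +
          nT) * (n01 + nT) ≤ r01 + rT)
    (h_pair_P01_P02 : Z * ((n01 + nT) * (n02 + nT) + (n02 + nT) * (n01 + nT)) - (n01 + n02 + n12 + nT) * (n01 +
          nT) * (n02 + nT) ≤ rT)
    (h_pair_P01_P12 : Z * ((n01 + nT) * (n12 + nT) + (n12 + nT) * (n01 + nT)) - (n01 + n02 + n12 + nT) * (n01 +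
          nT) * (n12 + nT) ≤ rT)
    (h_pair_P01_R0 : Z * ((n01 + nT) * (n01 + n02 + nT) + (n0 + n01 + n02 + nT) * (n01 + nT)) - (n01 + n02 + n12 +
          nT) * (n01 + nT) * (n0 + n01 + n02 + nT) ≤ r01 + rT)
    (h_pair_P01_R1 : Z * ((n01 + nT) * (n01 + n12 + nT) + (n1 + n01 + n12 + nT) * (n01 + nT)) - (n01 + n02 + n12 +
          nT) * (n01 + nT) * (n1 + n01 + n12 + nT) ≤ r01 + rT)
    (h_pair_P01_R2 : Z * ((n01 + nT) * (n02 + n12 + nT) + (n2 + n02 + n12 + nT) * (n01 + nT)) - (n01 + n02 + n12 +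
          nT) * (n01 + nT) * (n2 + n02 + n12 + nT) ≤ rT)
    (h_ut_01 : Z * Z * (n01 + nT) ≤ r01 + rT)
    (S' : Finset (Fin 3 → Bool)) (hS' : IsUpperSet (S' : Set (Fin 3 → Bool)))
    (hsS' : ∀ s ∈ Mᶜ, (∀ t ∈ M, s ≤ t → t ∈ S') → s ∈ S') :
    Z * ((∑ t ∈ ({![true, true, false], ![true, true, true]} : Finset (Fin 3 → Bool)), ν t) * (∑ t ∈ S' ∩ M, ν t)
        + (∑ t ∈ S', ν t) * (∑ t ∈ ({![true, true, false], ![true, true, true]} : Finset (Fin 3 → Bool)) ∩ M, ν t))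
        - (n01 + n02 + n12 + nT) * (∑ t ∈ ({![true, true, false], ![true, true, true]} : Finset (Fin 3 → Bool)),
              ν t) * (∑ t ∈ S', ν t)
      ≤ ∑ t ∈ (({![true, true, false], ![true, true, true]} : Finset (Fin 3 → Bool)) ∩ S') ∩ M, R t := by
  subst hM
  rcases sat_cases _ rfl S' hS' hsS' with rfl | rfl | rfl | rfl | rfl | rfl | rfl | rfl | rfl <;>
  · simp (disch := decide) only [Finset.empty_inter, Finset.inter_empty, Finset.univ_inter, Finset.inter_univ,
      Finset.insert_inter_of_mem, Finset.insert_inter_of_notMem, Finset.singleton_inter_of_mem,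
      Finset.sum_empty, Finset.sum_singleton, Finset.sum_insert, hZ,
      hR01, hRT, h0, h1, h2, h01, h02, h12, hT]
    linarith

/-- Row `S = P02` of the pair condition: the nine saturated `S'` (see `pair_all`). [this work] -/
theorem pair_row_P02 (M : Finset (Fin 3 → Bool))
    (hM : M = {![true, true, false], ![true, false, true], ![false, true, true], ![true, true,
          true]}) (ν : (Fin 3 → Bool) → ℝ) (n0 n1 n2 n01 n02 n12 nT Z : ℝ)
    (hZ : ∑ t, ν t = Z) (h0 : ν ![true, false, false] = n0) (h1 : ν ![false, true, false] = n1) (h2 : ν ![false,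
          false, true] = n2)
    (h01 : ν ![true, true, false] = n01) (h02 : ν ![true, false, true] = n02) (h12 : ν ![false, true,
          true] = n12) (hT : ν ![true, true, true] = nT) (r02 rT : ℝ)
    (R : (Fin 3 → Bool) → ℝ) (hR02 : R ![true, false, true] = r02) (hRT : R ![true, true, true] = rT)
    (h_pair_T_P02 : Z * (nT * (n02 + nT) + (n02 + nT) * nT) - (n01 + n02 + n12 + nT) * nT * (n02 + nT) ≤ rT)
    (h_pair_P01_P02 : Z * ((n01 + nT) * (n02 + nT) + (n02 + nT) * (n01 + nT)) - (n01 + n02 + n12 + nT) * (n01 +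
          nT) * (n02 + nT) ≤ rT)
    (h_pair_P02_P02 : Z * ((n02 + nT) * (n02 + nT) + (n02 + nT) * (n02 + nT)) - (n01 + n02 + n12 + nT) * (n02 +
          nT) * (n02 + nT) ≤ r02 + rT)
    (h_pair_P02_P12 : Z * ((n02 + nT) * (n12 + nT) + (n12 + nT) * (n02 + nT)) - (n01 + n02 + n12 + nT) * (n02 +
          nT) * (n12 + nT) ≤ rT)
    (h_pair_P02_R0 : Z * ((n02 + nT) * (n01 + n02 + nT) + (n0 + n01 + n02 + nT) * (n02 + nT)) - (n01 + n02 + n12 +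
          nT) * (n02 + nT) * (n0 + n01 + n02 + nT) ≤ r02 + rT)
    (h_pair_P02_R1 : Z * ((n02 + nT) * (n01 + n12 + nT) + (n1 + n01 + n12 + nT) * (n02 + nT)) - (n01 + n02 + n12 +
          nT) * (n02 + nT) * (n1 + n01 + n12 + nT) ≤ rT)
    (h_pair_P02_R2 : Z * ((n02 + nT) * (n02 + n12 + nT) + (n2 + n02 + n12 + nT) * (n02 + nT)) - (n01 + n02 + n12 +
          nT) * (n02 + nT) * (n2 + n02 + n12 + nT) ≤ r02 + rT)
    (h_ut_02 : Z * Z * (n02 + nT) ≤ r02 + rT)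
    (S' : Finset (Fin 3 → Bool)) (hS' : IsUpperSet (S' : Set (Fin 3 → Bool)))
    (hsS' : ∀ s ∈ Mᶜ, (∀ t ∈ M, s ≤ t → t ∈ S') → s ∈ S') :
    Z * ((∑ t ∈ ({![true, false, true], ![true, true, true]} : Finset (Fin 3 → Bool)), ν t) * (∑ t ∈ S' ∩ M, ν t)
        + (∑ t ∈ S', ν t) * (∑ t ∈ ({![true, false, true], ![true, true, true]} : Finset (Fin 3 → Bool)) ∩ M, ν t))
        - (n01 + n02 + n12 + nT) * (∑ t ∈ ({![true, false, true], ![true, true, true]} : Finset (Fin 3 → Bool)),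
              ν t) * (∑ t ∈ S', ν t)
      ≤ ∑ t ∈ (({![true, false, true], ![true, true, true]} : Finset (Fin 3 → Bool)) ∩ S') ∩ M, R t := by
  subst hM
  rcases sat_cases _ rfl S' hS' hsS' with rfl | rfl | rfl | rfl | rfl | rfl | rfl | rfl | rfl <;>
  · simp (disch := decide) only [Finset.empty_inter, Finset.inter_empty, Finset.univ_inter, Finset.inter_univ,
      Finset.insert_inter_of_mem, Finset.insert_inter_of_notMem, Finset.singleton_inter_of_mem,
      Finset.sum_empty, Finset.sum_singleton, Finset.sum_insert, hZ,
      hR02, hRT, h0, h1, h2, h01, h02, h12, hT]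
    linarith

/-- Row `S = P12` of the pair condition: the nine saturated `S'` (see `pair_all`). [this work] -/
theorem pair_row_P12 (M : Finset (Fin 3 → Bool))
    (hM : M = {![true, true, false], ![true, false, true], ![false, true, true], ![true, true,
          true]}) (ν : (Fin 3 → Bool) → ℝ) (n0 n1 n2 n01 n02 n12 nT Z : ℝ)
    (hZ : ∑ t, ν t = Z) (h0 : ν ![true, false, false] = n0) (h1 : ν ![false, true, false] = n1) (h2 : ν ![false,
          false, true] = n2)
    (h01 : ν ![true, true, false] = n01) (h02 : ν ![true, false, true] = n02) (h12 : ν ![false, true,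
          true] = n12) (hT : ν ![true, true, true] = nT) (r12 rT : ℝ)
    (R : (Fin 3 → Bool) → ℝ) (hR12 : R ![false, true, true] = r12) (hRT : R ![true, true, true] = rT)
    (h_pair_T_P12 : Z * (nT * (n12 + nT) + (n12 + nT) * nT) - (n01 + n02 + n12 + nT) * nT * (n12 + nT) ≤ rT)
    (h_pair_P01_P12 : Z * ((n01 + nT) * (n12 + nT) + (n12 + nT) * (n01 + nT)) - (n01 + n02 + n12 + nT) * (n01 +
          nT) * (n12 + nT) ≤ rT)
    (h_pair_P02_P12 : Z * ((n02 + nT) * (n12 + nT) + (n12 + nT) * (n02 + nT)) - (n01 + n02 + n12 + nT) * (n02 +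
          nT) * (n12 + nT) ≤ rT)
    (h_pair_P12_P12 : Z * ((n12 + nT) * (n12 + nT) + (n12 + nT) * (n12 + nT)) - (n01 + n02 + n12 + nT) * (n12 +
          nT) * (n12 + nT) ≤ r12 + rT)
    (h_pair_P12_R0 : Z * ((n12 + nT) * (n01 + n02 + nT) + (n0 + n01 + n02 + nT) * (n12 + nT)) - (n01 + n02 + n12 +
          nT) * (n12 + nT) * (n0 + n01 + n02 + nT) ≤ rT)
    (h_pair_P12_R1 : Z * ((n12 + nT) * (n01 + n12 + nT) + (n1 + n01 + n12 + nT) * (n12 + nT)) - (n01 + n02 + n12 +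
          nT) * (n12 + nT) * (n1 + n01 + n12 + nT) ≤ r12 + rT)
    (h_pair_P12_R2 : Z * ((n12 + nT) * (n02 + n12 + nT) + (n2 + n02 + n12 + nT) * (n12 + nT)) - (n01 + n02 + n12 +
          nT) * (n12 + nT) * (n2 + n02 + n12 + nT) ≤ r12 + rT)
    (h_ut_12 : Z * Z * (n12 + nT) ≤ r12 + rT)
    (S' : Finset (Fin 3 → Bool)) (hS' : IsUpperSet (S' : Set (Fin 3 → Bool)))
    (hsS' : ∀ s ∈ Mᶜ, (∀ t ∈ M, s ≤ t → t ∈ S') → s ∈ S') :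
    Z * ((∑ t ∈ ({![false, true, true], ![true, true, true]} : Finset (Fin 3 → Bool)), ν t) * (∑ t ∈ S' ∩ M, ν t)
        + (∑ t ∈ S', ν t) * (∑ t ∈ ({![false, true, true], ![true, true, true]} : Finset (Fin 3 → Bool)) ∩ M, ν t))
        - (n01 + n02 + n12 + nT) * (∑ t ∈ ({![false, true, true], ![true, true, true]} : Finset (Fin 3 → Bool)),
              ν t) * (∑ t ∈ S', ν t)
      ≤ ∑ t ∈ (({![false, true, true], ![true, true, true]} : Finset (Fin 3 → Bool)) ∩ S') ∩ M, R t := by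
  subst hM
  rcases sat_cases _ rfl S' hS' hsS' with rfl | rfl | rfl | rfl | rfl | rfl | rfl | rfl | rfl <;>
  · simp (disch := decide) only [Finset.empty_inter, Finset.inter_empty, Finset.univ_inter, Finset.inter_univ,
      Finset.insert_inter_of_mem, Finset.insert_inter_of_notMem, Finset.singleton_inter_of_mem,
      Finset.sum_empty, Finset.sum_singleton, Finset.sum_insert, hZ,
      hR12, hRT, h0, h1, h2, h01, h02, h12, hT]
    linarith

end Summit.CriticalPhenomena.PercolationContinuityZ3.Theorems.SahiE3MajPattern
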